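import Mathlib.RingTheory.Valuation.LocalSubring
import Literature.NumberTheory.DiophantineGeometry.FunctionFieldDivisorsConstantsProofs
import Literature.NumberTheory.DiophantineGeometry.FunctionFieldDivisorsOrdProofs
import Literature.NumberTheory.DiophantineGeometry.FunctionFieldDivisorsOrdAddProofs
import Literature.NumberTheory.DiophantineGeometry.FunctionFieldDivisorsLinearEquivalenceProofs
import Literature.NumberTheory.DiophantineGeometry.FunctionFieldGenusProofs
import Literature.NumberTheory.DiophantineGeometry.FunctionFieldGenusDegreePosProofs
import Literature.NumberTheory.DiophantineGeometry.FunctionFieldGenusEllZeroProofs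
import HarnessLib

/-!
# Algebraic function fields of one variable — independence of valuations (Stichtenoth §1.3)

Sibling proof file of `Literature.NumberTheory.DiophantineGeometry.FunctionFieldGenus` and
`…FunctionFieldDivisors` (D-0014 append protocol: those files stay definitions/named-facts files).
It develops §1.3 of Stichtenoth's book on top of the vendored `PlaceOver`/`ord`/`Divisor` API and
discharges three named facts on the way:

* `PlaceOver.valuation_le_pow_iff_holds` (Stichtenoth Def. 1.1.12 / Thm. 1.1.13 (a)) and
  `PlaceOver.ord_uniformizer_holds` (Thm. 1.1.13 (b)) — the bridge between the abstract valuation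
  of `O_v` and the normalised `ℤ`-valued `ord_v`, read off from `PlaceOver.valuation_eq_zpow_ord`
  (`v(x) = v(π_v)^{ord_v x}`, file `FunctionFieldDivisorsLinearEquivalenceProofs`); the strict
  triangle inequality (Lemma 1.1.11) is derived the same way (the plain triangle inequality
  `PlaceOver.min_ord_le_ord_add_holds` is the sibling file `FunctionFieldDivisorsOrdAddProofs`);
* `finite_setOf_ord_ne_zero_holds` (**Cor. 1.3.4**: a nonzero element has only finitely many zeros
  and poles), which kills the junk value of `principalDivisor` (`principalDivisor_apply_of_ne_zero`).

## Source and proof architecture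

H. Stichtenoth, *Algebraic Function Fields and Codes*, 2nd ed., GTM 254 (2009), §1.1 and §1.3,
read in the held copy `book:stichtenothnd-algebraic-function-fields-codes` (pdf pp. 12–24).

* **Thm. 1.1.13 (d)** (valuation rings are maximal proper subrings) ⇒ valuation rings of distinct
  places are incomparable (`PlaceOver.exists_mem_and_notMem_of_ne`).
* **Thm. 1.3.1 (Weak Approximation)**, proof Steps 1–3 as printed:
  `PlaceOver.exists_ord_pos_forall_ord_neg` (Step 1: `v_P(u) > 0`, `v_Q(u) < 0` for `Q ∈ S`, by
  induction on `S` with `u ↦ y + z^r` and the strict triangle inequality),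
  `PlaceOver.exists_approx_one` (Step 2: `w = (1 + u^s)⁻¹`), `PlaceOver.exists_approx_single` and
  `PlaceOver.exists_forall_valuation_sub_le` (Step 3: simultaneous approximation
  `v_P(z - a_P) ≥ N_P`), and the theorem itself `PlaceOver.weakApproximation`
  (`v_P(x - x_P) = r_P`). Inequalities `v_P(t) ≥ N` are phrased through the valuation,
  `v(t) ≤ v(π_P)^N`, so that they cover `t = 0` (the vendored `ord_v` has the junk value
  `ord_v 0 = 0` where the book has `v_P(0) = ∞`).
* **Prop. 1.3.3** (`sum_ord_mul_degree_le_finrank`: `∑ v_{P_i}(x) deg P_i ≤ [F : K(x)]` over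
  finitely many zeros `P_i` of a transcendental `x`). We prove it by a variant of the printed
  argument that needs only the *additive* form of weak approximation: instead of `t_i^a z_{ij}`
  with `v_i(t_i) = 1`, `v_k(t_i) = 0`, we use elements `w_{P,a,j}` approximating `π_P^a s_{P,j}`
  at `P` to order `e_P = v_P(x)` and vanishing to order `e_Q` at the other zeros `Q`; the linear
  independence over `K(x)` is then the computation (1.13)–(1.16) of the book
  (`coeff_zero_eq_zero_of_sum_aeval_mul_approx_eq_zero`: fix `P`, strong induction on the
  exponent `c`, every other term has positive valuation at `P`, reduce modulo `P`), followed by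
  the "not all `φ` divisible by `x`" step in the form of an induction on coefficients
  (`eq_zero_of_sum_aeval_mul_eq_zero`, `linearIndependent_adjoin_simple_of_coeff_zero`, as in the
  vendored proof of Prop. 1.1.15). `[F : K(x)] < ∞` is Remark 1.1.2
  (`IsAlgFunctionField.finiteDimensional_adjoin_simple`), `deg P < ∞` is Prop. 1.1.15
  (`PlaceOver.finiteDimensional_residueField_holds`).
* **Cor. 1.3.4** (`finite_setOf_ord_pos`, `finite_setOf_ord_ne_zero_holds`): constants (elements
  algebraic over `K`) have no zeros or poles (Prop. 1.1.5 (c),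
  `IsAlgFunctionField.mem_valuationSubring_of_isAlgebraic`); a transcendental `x` has at most
  `[F : K(x)]` zeros by Prop. 1.3.3, and its poles are the zeros of `x⁻¹`.

All statements discharged here were compared with the printed text; none is weakened or
mis-stated (`valuation_le_pow_iff` carries the hypothesis `x ≠ 0` exactly where the junk value
`ord_v 0 = 0` requires it; Cor. 1.3.4 is stated for `x ≠ 0` as printed).

## References

* H. Stichtenoth, *Algebraic Function Fields and Codes*, 2nd ed., GTM 254, Springer 2009, §1.1
  (Prop. 1.1.5, Def. 1.1.9, Lemma 1.1.11, Def. 1.1.12, Thm. 1.1.13, Prop. 1.1.15) and §1.3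
  (Thm. 1.3.1, Prop. 1.3.3, Cor. 1.3.4), pp. 2–14. doi:10.1007/978-3-540-76878-4
-/

noncomputable section

open scoped Classical

namespace Literature.NumberTheory.DiophantineGeometry.AlgFunctionField

universe u v

variable {K : Type u} {F : Type v} [Field K] [Field F] [Algebra K F]

namespace PlaceOver

/-! ### The normalised valuation `ord_v` versus the abstract valuation (Stichtenoth §1.1) -/

/-- `v(π_v) < 1`: a uniformizer lies in the maximal ideal (Stichtenoth Thm. 1.1.13 (a),(b):
`P = {z | v_P(z) > 0}` and prime elements have `v_P = 1`). [cite: Stichtenoth2009, Thm. 1.1.13] -/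
theorem valuation_uniformizer_lt_one (v : PlaceOver K F) :
    v.valuation (v.uniformizer : F) < 1 :=
  (v.toValuationSubring.valuation_lt_one_iff _).1
    ((IsLocalRing.mem_maximalIdeal _).2 (mem_nonunits_iff.2 v.irreducible_uniformizer.not_isUnit))

/-- `0 < v(π_v)` (a uniformizer is nonzero). [folklore] -/
theorem valuation_uniformizer_pos (v : PlaceOver K F) :
    0 < v.valuation (v.uniformizer : F) :=
  zero_lt_iff.2 v.valuation_uniformizer_ne_zero

/-- `n ↦ v(π_v)ⁿ` is strictly decreasing on `ℤ` (as `0 < v(π_v) < 1`), the order-reversing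
identification of `ℤ` with the value group used throughout Stichtenoth §1.1 (Def. 1.1.12,
Thm. 1.1.13). [folklore] -/
theorem zpow_valuation_uniformizer_strictAnti (v : PlaceOver K F) :
    StrictAnti fun n : ℤ ↦ v.valuation (v.uniformizer : F) ^ n :=
  zpow_right_strictAnti₀ v.valuation_uniformizer_pos v.valuation_uniformizer_lt_one

/-- **Discharge of `PlaceOver.valuation_le_pow_iff`**: for `x ≠ 0` and `n ∈ ℤ`,
`v(x) ≤ v(π_v)ⁿ ↔ n ≤ ord_v x` (Stichtenoth Thm. 1.1.6 (b), Def. 1.1.12, Thm. 1.1.13 (a): `x = u π_vᵐ`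
with `m = v_P(x)`, and `m ↦ v(π_v)ᵐ` is order-reversing). [cite: Stichtenoth2009, Def. 1.1.12 and Thm. 1.1.13(a)] -/
theorem valuation_le_pow_iff_holds : valuation_le_pow_iff (K := K) (F := F) := by
  intro v x hx n
  rw [v.valuation_eq_zpow_ord hx]
  exact zpow_le_zpow_iff_right_of_lt_one₀ v.valuation_uniformizer_pos
    v.valuation_uniformizer_lt_one

/-- For `x ≠ 0` and `n ∈ ℤ`: `v(x) ≤ v(π_v)ⁿ ↔ n ≤ ord_v x` (pointwise form of
`valuation_le_pow_iff_holds`; Stichtenoth Def. 1.1.12, Thm. 1.1.13 (a)). [cite: Stichtenoth2009, Def. 1.1.12 and Thm. 1.1.13(a)] -/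
theorem valuation_le_zpow_iff_le_ord (v : PlaceOver K F) {x : F} (hx : x ≠ 0) (n : ℤ) :
    v.valuation x ≤ v.valuation (v.uniformizer : F) ^ n ↔ n ≤ v.ord x :=
  valuation_le_pow_iff_holds v hx n

/-- For `x ≠ 0` and `n ∈ ℤ`: `v(x) < v(π_v)ⁿ ↔ n < ord_v x` (strict form of Stichtenoth
Thm. 1.1.13 (a)). [cite: Stichtenoth2009, Def. 1.1.12 and Thm. 1.1.13(a)] -/
theorem valuation_lt_zpow_iff_lt_ord (v : PlaceOver K F) {x : F} (hx : x ≠ 0) (n : ℤ) :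
    v.valuation x < v.valuation (v.uniformizer : F) ^ n ↔ n < v.ord x := by
  rw [v.valuation_eq_zpow_ord hx]
  exact zpow_lt_zpow_iff_right_of_lt_one₀ v.valuation_uniformizer_pos
    v.valuation_uniformizer_lt_one

/-- For `x ≠ 0` and `n ∈ ℤ`: `v(π_v)ⁿ ≤ v(x) ↔ ord_v x ≤ n`. [cite: Stichtenoth2009, Def. 1.1.12 and Thm. 1.1.13(a)] -/
theorem zpow_le_valuation_iff_ord_le (v : PlaceOver K F) {x : F} (hx : x ≠ 0) (n : ℤ) :
    v.valuation (v.uniformizer : F) ^ n ≤ v.valuation x ↔ v.ord x ≤ n := by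
  rw [v.valuation_eq_zpow_ord hx]
  exact zpow_le_zpow_iff_right_of_lt_one₀ v.valuation_uniformizer_pos
    v.valuation_uniformizer_lt_one

/-- For `x ≠ 0` and `n ∈ ℤ`: `v(π_v)ⁿ < v(x) ↔ ord_v x < n`. [cite: Stichtenoth2009, Def. 1.1.12 and Thm. 1.1.13(a)] -/
theorem zpow_lt_valuation_iff_ord_lt (v : PlaceOver K F) {x : F} (hx : x ≠ 0) (n : ℤ) :
    v.valuation (v.uniformizer : F) ^ n < v.valuation x ↔ v.ord x < n := by
  rw [v.valuation_eq_zpow_ord hx]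
  exact zpow_lt_zpow_iff_right_of_lt_one₀ v.valuation_uniformizer_pos
    v.valuation_uniformizer_lt_one

/-- For `x ≠ 0` and `n ∈ ℤ`: `v(x) = v(π_v)ⁿ ↔ ord_v x = n` (Stichtenoth Def. 1.1.12: `v_P` is
well defined). [cite: Stichtenoth2009, Def. 1.1.12] -/
theorem valuation_eq_zpow_iff_ord_eq (v : PlaceOver K F) {x : F} (hx : x ≠ 0) (n : ℤ) :
    v.valuation x = v.valuation (v.uniformizer : F) ^ n ↔ v.ord x = n := by
  rw [v.valuation_eq_zpow_ord hx]
  exact v.zpow_valuation_uniformizer_strictAnti.injective.eq_iff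

/-- **Discharge of `PlaceOver.ord_uniformizer`**: `ord_v π_v = 1` (Stichtenoth Thm. 1.1.13 (b):
prime elements are exactly the elements of valuation `1`). [cite: Stichtenoth2009, Thm. 1.1.13(b)] -/
theorem ord_uniformizer_holds : ord_uniformizer (K := K) (F := F) := by
  intro v
  have h0 : (v.uniformizer : F) ≠ 0 := fun h ↦ v.irreducible_uniformizer.ne_zero (Subtype.ext h)
  exact (v.valuation_eq_zpow_iff_ord_eq h0 1).1 (zpow_one _).symm

/-- `ord_v π_v = 1` (pointwise form of `ord_uniformizer_holds`). [cite: Stichtenoth2009, Thm. 1.1.13(b)] -/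
theorem ord_uniformizer_eq_one (v : PlaceOver K F) : v.ord (v.uniformizer : F) = 1 :=
  ord_uniformizer_holds v

/-- The uniformizer is a nonzero element of `F`. [folklore] -/
theorem coe_uniformizer_ne_zero (v : PlaceOver K F) : (v.uniformizer : F) ≠ 0 := fun h ↦
  v.irreducible_uniformizer.ne_zero (Subtype.ext h)

/-- `ord_v (π_vⁿ) = n` for `n ∈ ℤ`. [cite: Stichtenoth2009, Def. 1.1.12] -/
theorem ord_uniformizer_zpow (v : PlaceOver K F) (n : ℤ) : v.ord ((v.uniformizer : F) ^ n) = n :=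
  (v.valuation_eq_zpow_iff_ord_eq (zpow_ne_zero n v.coe_uniformizer_ne_zero) n).1 (map_zpow₀ _ _ _)

/-- For `x ≠ 0`: `x ∈ O_v ↔ 0 ≤ ord_v x` (Stichtenoth Thm. 1.1.13 (a)). [cite: Stichtenoth2009, Thm. 1.1.13(a)] -/
theorem mem_toValuationSubring_iff_ord_nonneg (v : PlaceOver K F) {x : F} (hx : x ≠ 0) :
    x ∈ v.toValuationSubring ↔ 0 ≤ v.ord x := by
  rw [← v.toValuationSubring.valuation_le_one_iff, ← v.valuation_le_zpow_iff_le_ord hx 0, zpow_zero]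

/-- For `x ≠ 0`: `v(x) < 1 ↔ 0 < ord_v x`, i.e. `x ∈ P ↔ v_P(x) > 0` (Stichtenoth Thm. 1.1.13 (a)). [cite: Stichtenoth2009, Thm. 1.1.13(a)] -/
theorem valuation_lt_one_iff_ord_pos (v : PlaceOver K F) {x : F} (hx : x ≠ 0) :
    v.valuation x < 1 ↔ 0 < v.ord x := by
  rw [← v.valuation_lt_zpow_iff_lt_ord hx 0, zpow_zero]

/-- For `x ≠ 0`: `1 < v(x) ↔ ord_v x < 0`, i.e. `x ∉ O_P ↔ v_P(x) < 0` (poles; Stichtenoth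
Def. 1.1.18 with Thm. 1.1.13 (a)). [cite: Stichtenoth2009, Thm. 1.1.13(a) and Def. 1.1.18] -/
theorem one_lt_valuation_iff_ord_neg (v : PlaceOver K F) {x : F} (hx : x ≠ 0) :
    1 < v.valuation x ↔ v.ord x < 0 := by
  rw [← not_le, ← not_le, not_iff_not, ← zpow_zero (v.valuation (v.uniformizer : F)),
    v.valuation_le_zpow_iff_le_ord hx 0]

/-- `ord_v 1 = 0`. [cite: Stichtenoth2009, Def. 1.1.9] -/
theorem ord_one (v : PlaceOver K F) : v.ord (1 : F) = 0 :=
  (v.valuation_eq_zpow_iff_ord_eq one_ne_zero 0).1 (by rw [map_one, zpow_zero])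

/-- `ord_v (-x) = ord_v x`. [cite: Stichtenoth2009, Lemma 1.1.11 (proof)] -/
theorem ord_neg (v : PlaceOver K F) (x : F) : v.ord (-x) = v.ord x := by
  by_cases hx : x = 0
  · rw [hx, neg_zero]
  · exact (v.valuation_eq_zpow_iff_ord_eq (neg_ne_zero.2 hx) _).1
      (by rw [Valuation.map_neg, v.valuation_eq_zpow_ord hx])

/-- `ord_v (x y) = ord_v x + ord_v y` for `x, y ≠ 0` (pointwise form of `ord_mul_holds`,
Stichtenoth Def. 1.1.9 (2)). [cite: Stichtenoth2009, Def. 1.1.9(2) and Thm. 1.1.13(a)] -/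
theorem ord_mul_eq (v : PlaceOver K F) {x y : F} (hx : x ≠ 0) (hy : y ≠ 0) :
    v.ord (x * y) = v.ord x + v.ord y :=
  ord_mul_holds v hx hy

/-- `ord_v (xⁿ) = n · ord_v x` for `x ≠ 0`, `n ∈ ℤ`. [cite: Stichtenoth2009, Def. 1.1.9(2)] -/
theorem ord_zpow (v : PlaceOver K F) {x : F} (hx : x ≠ 0) (n : ℤ) : v.ord (x ^ n) = n * v.ord x :=
  (v.valuation_eq_zpow_iff_ord_eq (zpow_ne_zero n hx) _).1
    (by rw [map_zpow₀, v.valuation_eq_zpow_ord hx, ← zpow_mul, mul_comm])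

/-- `ord_v (xⁿ) = n · ord_v x` for `x ≠ 0`, `n ∈ ℕ`. [cite: Stichtenoth2009, Def. 1.1.9(2)] -/
theorem ord_pow (v : PlaceOver K F) {x : F} (hx : x ≠ 0) (n : ℕ) : v.ord (x ^ n) = n * v.ord x := by
  rw [← zpow_natCast, v.ord_zpow hx]

/-- `ord_v (x / y) = ord_v x - ord_v y` for `x, y ≠ 0`. [cite: Stichtenoth2009, Def. 1.1.9(2)] -/
theorem ord_div (v : PlaceOver K F) {x y : F} (hx : x ≠ 0) (hy : y ≠ 0) :
    v.ord (x / y) = v.ord x - v.ord y := by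
  rw [div_eq_mul_inv, v.ord_mul_eq hx (inv_ne_zero hy), v.ord_inv hy, sub_eq_add_neg]

/-- **Strict triangle inequality** (Stichtenoth Lemma 1.1.11): if `ord_v x < ord_v y` (`x, y ≠ 0`)
then `x + y ≠ 0` and `ord_v (x + y) = ord_v x`. [cite: Stichtenoth2009, Lemma 1.1.11] -/
theorem ord_add_eq_left_of_lt (v : PlaceOver K F) {x y : F} (hx : x ≠ 0) (hy : y ≠ 0)
    (h : v.ord x < v.ord y) : x + y ≠ 0 ∧ v.ord (x + y) = v.ord x := by
  have hlt : v.valuation y < v.valuation x := by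
    rw [v.valuation_eq_zpow_ord hy, v.zpow_lt_valuation_iff_ord_lt hx]
    exact h
  have hxy : x + y ≠ 0 := by
    intro h0
    rw [add_eq_zero_iff_eq_neg.1 h0, Valuation.map_neg] at hlt
    exact lt_irrefl _ hlt
  refine ⟨hxy, (v.valuation_eq_zpow_iff_ord_eq hxy _).1 ?_⟩
  rw [Valuation.map_add_eq_of_lt_left _ hlt, v.valuation_eq_zpow_ord hx]

/-- Symmetric form of the strict triangle inequality (Stichtenoth Lemma 1.1.11): if
`ord_v x ≠ ord_v y` (`x, y ≠ 0`) then `x + y ≠ 0` and `ord_v (x + y) = min (ord_v x) (ord_v y)`.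
[cite: Stichtenoth2009, Lemma 1.1.11] -/
theorem ord_add_eq_min_of_ne (v : PlaceOver K F) {x y : F} (hx : x ≠ 0) (hy : y ≠ 0)
    (h : v.ord x ≠ v.ord y) : x + y ≠ 0 ∧ v.ord (x + y) = min (v.ord x) (v.ord y) := by
  rcases lt_or_gt_of_ne h with hlt | hlt
  · rw [min_eq_left hlt.le]
    exact v.ord_add_eq_left_of_lt hx hy hlt
  · rw [min_eq_right hlt.le, add_comm]
    exact v.ord_add_eq_left_of_lt hy hx hlt

/-! ### Independence of valuations (Stichtenoth §1.3) -/

/-- Valuation rings of distinct places are incomparable: if `v ≠ w` there is `y ∈ O_v` with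
`y ∉ O_w` (Stichtenoth Thm. 1.1.13 (d): a valuation ring of `F/K` is a maximal proper subring of
`F` — if `O_v ⊆ O_w` and `z ∈ O_w ∖ O_v` then every `y ∈ F` is `(y z⁻ᵏ) zᵏ ∈ O_w` for `k` large,
so `O_w = F`; used in Step 1 of the proof of Thm. 1.3.1). [cite: Stichtenoth2009, Thm. 1.1.13(d)] -/
theorem exists_mem_and_notMem_of_ne {v w : PlaceOver K F} (h : v ≠ w) :
    ∃ y : F, y ∈ v.toValuationSubring ∧ y ∉ w.toValuationSubring := by
  by_contra! hsub
  have hne : v.toValuationSubring ≠ w.toValuationSubring := fun e ↦ h (PlaceOver.ext e)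
  obtain ⟨z, hzw, hzv⟩ : ∃ z, z ∈ w.toValuationSubring ∧ z ∉ v.toValuationSubring := by
    by_contra! h'
    exact hne (le_antisymm (fun y hy ↦ hsub y hy) fun y hy ↦ h' y hy)
  have hz0 : z ≠ 0 := fun h0 ↦ hzv (h0 ▸ zero_mem _)
  have hzneg : v.ord z < 0 := by
    rw [← not_le, ← v.mem_toValuationSubring_iff_ord_nonneg hz0]
    exact hzv
  apply w.ne_top
  refine eq_top_iff.2 fun y _ ↦ ?_
  by_cases hy : y = 0
  · rw [hy]; exact zero_mem _
  set k : ℕ := (v.ord y).natAbs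
  have hzk : z ^ k ≠ 0 := pow_ne_zero _ hz0
  have hmem : y * (z ^ k)⁻¹ ∈ v.toValuationSubring := by
    rw [v.mem_toValuationSubring_iff_ord_nonneg (mul_ne_zero hy (inv_ne_zero hzk)),
      v.ord_mul_eq hy (inv_ne_zero hzk), v.ord_inv hzk, v.ord_pow hz0]
    have h1 : -v.ord z ≥ 1 := by omega
    have h2 : (k : ℤ) = |v.ord y| := Int.natCast_natAbs _
    have h3 : v.ord y + |v.ord y| ≥ 0 := by
      rcases abs_cases (v.ord y) with ⟨h, _⟩ | ⟨h, _⟩ <;> omega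
    nlinarith [abs_nonneg (v.ord y)]
  have hy' : y = y * (z ^ k)⁻¹ * z ^ k := by rw [mul_assoc, inv_mul_cancel₀ hzk, mul_one]
  rw [hy']
  exact mul_mem (hsub _ hmem) (pow_mem hzw k)

/-- **Step 1 of the proof of Stichtenoth Thm. 1.3.1**: for a place `P` and finitely many places
`Q ∈ S`, `P ∉ S`, there is `u ∈ F` with `v_P(u) > 0` and `v_Q(u) < 0` for all `Q ∈ S`. Proof as
printed: induction on `S`; for two places use `y₁ ∈ O_P ∖ O_Q`, `y₂ ∈ O_Q ∖ O_P`, `u = y₁ / y₂`;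
in the inductive step replace `y` by `y + zʳ` with `r` chosen so that `r · v_i(z) ≠ v_i(y)`, and
apply the strict triangle inequality. [cite: Stichtenoth2009, Thm. 1.3.1 (proof, Step 1)] -/
theorem exists_ord_pos_forall_ord_neg (S : Finset (PlaceOver K F)) {P : PlaceOver K F}
    (hP : P ∉ S) : ∃ u : F, u ≠ 0 ∧ 0 < P.ord u ∧ ∀ Q ∈ S, Q.ord u < 0 := by
  induction S using Finset.induction_on with
  | empty =>
    exact ⟨P.uniformizer, P.coe_uniformizer_ne_zero, by rw [P.ord_uniformizer_eq_one]; exact one_pos,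
      fun Q hQ ↦ (Finset.notMem_empty Q hQ).elim⟩
  | insert Q S hQS ih =>
    have hPS : P ∉ S := fun h ↦ hP (Finset.mem_insert_of_mem h)
    have hPQ : P ≠ Q := fun h ↦ hP (h ▸ Finset.mem_insert_self Q S)
    obtain ⟨y, hy0, hyP, hyS⟩ := ih hPS
    by_cases hyQ : Q.ord y < 0
    · refine ⟨y, hy0, hyP, fun Q' hQ' ↦ ?_⟩
      rcases Finset.mem_insert.1 hQ' with rfl | h
      · exact hyQ
      · exact hyS _ h
    -- an element `z` with `v_P(z) > 0 > v_Q(z)`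
    obtain ⟨y₁, hy₁P, hy₁Q⟩ := exists_mem_and_notMem_of_ne hPQ
    obtain ⟨y₂, hy₂Q, hy₂P⟩ := exists_mem_and_notMem_of_ne hPQ.symm
    have hy₁0 : y₁ ≠ 0 := fun h ↦ hy₁Q (h ▸ zero_mem _)
    have hy₂0 : y₂ ≠ 0 := fun h ↦ hy₂P (h ▸ zero_mem _)
    have hz0 : y₁ / y₂ ≠ 0 := div_ne_zero hy₁0 hy₂0
    have hzP : 0 < P.ord (y₁ / y₂) := by
      rw [P.ord_div hy₁0 hy₂0]
      have h1 := (P.mem_toValuationSubring_iff_ord_nonneg hy₁0).1 hy₁P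
      have h2 : ¬ 0 ≤ P.ord y₂ := fun h ↦ hy₂P ((P.mem_toValuationSubring_iff_ord_nonneg hy₂0).2 h)
      omega
    have hzQ : Q.ord (y₁ / y₂) < 0 := by
      rw [Q.ord_div hy₁0 hy₂0]
      have h1 : ¬ 0 ≤ Q.ord y₁ := fun h ↦ hy₁Q ((Q.mem_toValuationSubring_iff_ord_nonneg hy₁0).2 h)
      have h2 := (Q.mem_toValuationSubring_iff_ord_nonneg hy₂0).1 hy₂Q
      omega
    set z := y₁ / y₂ with hz_def
    -- the exponent `r`: larger than `|v_i(y)|` for `i = P` and all `i ∈ S`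
    set r : ℕ := 1 + (P.ord y).natAbs + ∑ Q' ∈ S, (Q'.ord y).natAbs with hr_def
    have hr1 : 1 ≤ r := by omega
    have hzr0 : z ^ r ≠ 0 := pow_ne_zero _ hz0
    have hrP : (P.ord y).natAbs < r := by omega
    have hrS : ∀ Q' ∈ S, (Q'.ord y).natAbs < r := fun Q' hQ' ↦ by
      have := Finset.single_le_sum (fun i _ ↦ Nat.zero_le _) hQ' (f := fun i : PlaceOver K F ↦ (i.ord y).natAbs)
      omega
    -- `r · v_i(z) ≠ v_i(y)` for `i = P` and `i ∈ S`
    have hneP : P.ord y ≠ P.ord (z ^ r) := by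
      rw [P.ord_pow hz0]
      intro h
      have : ((P.ord y).natAbs : ℤ) < r := by exact_mod_cast hrP
      have habs := Int.natCast_natAbs (P.ord y)
      rw [habs] at this
      have : |P.ord y| ≥ r := by
        rw [h, abs_mul, Nat.abs_cast]
        nlinarith [abs_pos.2 (show P.ord z ≠ 0 by omega), Int.one_le_abs (show P.ord z ≠ 0 by omega)]
      omega
    have hneS : ∀ Q' ∈ S, Q'.ord y ≠ Q'.ord (z ^ r) := by
      intro Q' hQ' h
      rw [Q'.ord_pow hz0] at h
      have hy' := hyS Q' hQ'
      rcases eq_or_ne (Q'.ord z) 0 with h0 | h0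
      · rw [h0, mul_zero] at h; omega
      · have : ((Q'.ord y).natAbs : ℤ) < r := by exact_mod_cast hrS Q' hQ'
        rw [Int.natCast_natAbs] at this
        have : |Q'.ord y| ≥ r := by
          rw [h, abs_mul, Nat.abs_cast]
          nlinarith [Int.one_le_abs h0]
        omega
    refine ⟨y + z ^ r, (P.ord_add_eq_min_of_ne hy0 hzr0 hneP).1, ?_, fun Q' hQ' ↦ ?_⟩
    · rw [(P.ord_add_eq_min_of_ne hy0 hzr0 hneP).2, P.ord_pow hz0]
      exact lt_min hyP (by positivity)
    · rcases Finset.mem_insert.1 hQ' with rfl | h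
      · -- at `Q`: `v_Q(y) ≥ 0 > r · v_Q(z)`
        have hlt : Q'.ord (z ^ r) < Q'.ord y := by
          rw [Q'.ord_pow hz0]
          have : (r : ℤ) * Q'.ord z ≤ Q'.ord z := by nlinarith
          omega
        rw [add_comm, (Q'.ord_add_eq_left_of_lt hzr0 hy0 hlt).2, Q'.ord_pow hz0]
        have : (r : ℤ) * Q'.ord z ≤ Q'.ord z := by nlinarith
        omega
      · rw [(Q'.ord_add_eq_min_of_ne hy0 hzr0 (hneS Q' h)).2]
        exact min_lt_of_left_lt (hyS Q' h)

/-- **Step 2 of the proof of Stichtenoth Thm. 1.3.1**: for a place `P`, finitely many places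
`Q ∈ S` with `P ∉ S`, and `N ∈ ℤ`, there is `w ∈ F` with `v_P(w - 1) ≥ N` and `v_Q(w) ≥ N` for all
`Q ∈ S` (inequalities stated through the valuations, `v(t) ≤ v(π)ᴺ`, so that they also cover
`t = 0`). Proof as printed: `w = (1 + uˢ)⁻¹` with `u` from Step 1 and `s` large.
[cite: Stichtenoth2009, Thm. 1.3.1 (proof, Step 2)] -/
theorem exists_approx_one (S : Finset (PlaceOver K F)) {P : PlaceOver K F} (hP : P ∉ S) (N : ℤ) :
    ∃ w : F, P.valuation (w - 1) ≤ P.valuation (P.uniformizer : F) ^ N ∧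
      ∀ Q ∈ S, Q.valuation w ≤ Q.valuation (Q.uniformizer : F) ^ N := by
  obtain ⟨u, hu0, huP, huS⟩ := exists_ord_pos_forall_ord_neg S hP
  set s : ℕ := N.toNat + 1 with hs_def
  have hsN : N ≤ s := by push_cast [hs_def]; omega
  have hus0 : u ^ s ≠ 0 := pow_ne_zero _ hu0
  -- `v_P(1 + uˢ) = 0` and `1 + uˢ ≠ 0`
  have hP1 : (1 : F) + u ^ s ≠ 0 ∧ P.ord (1 + u ^ s) = 0 := by
    have h := P.ord_add_eq_left_of_lt one_ne_zero hus0
      (by rw [P.ord_one, P.ord_pow hu0]; positivity)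
    rwa [P.ord_one] at h
  refine ⟨(1 + u ^ s)⁻¹, ?_, fun Q hQ ↦ ?_⟩
  · have hw1 : (1 + u ^ s)⁻¹ - 1 = -u ^ s * (1 + u ^ s)⁻¹ := by
      field_simp [hP1.1]
      ring
    rw [hw1, P.valuation_le_zpow_iff_le_ord (mul_ne_zero (neg_ne_zero.2 hus0) (inv_ne_zero hP1.1)),
      P.ord_mul_eq (neg_ne_zero.2 hus0) (inv_ne_zero hP1.1), P.ord_neg, P.ord_inv hP1.1, hP1.2,
      P.ord_pow hu0]
    nlinarith
  · -- at `Q ∈ S`: `v_Q(1 + uˢ) = s · v_Q(u) < 0`, so `v_Q(w) = -s · v_Q(u) ≥ s ≥ N`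
    have hQ1 : (1 : F) + u ^ s ≠ 0 ∧ Q.ord (1 + u ^ s) = Q.ord (u ^ s) := by
      have h := Q.ord_add_eq_left_of_lt hus0 one_ne_zero
        (by rw [Q.ord_one, Q.ord_pow hu0]; nlinarith [huS Q hQ])
      rwa [add_comm] at h
    rw [Q.valuation_le_zpow_iff_le_ord (inv_ne_zero hQ1.1), Q.ord_inv hQ1.1, hQ1.2, Q.ord_pow hu0]
    nlinarith [huS Q hQ]

/-- Monotonicity of the "balls" `{t | v(t) ≤ v(π_v)ⁿ}`: `v(π_v)ᵐ ≤ v(π_v)ⁿ` for `n ≤ m`. [folklore] -/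
theorem zpow_valuation_uniformizer_le_of_le (v : PlaceOver K F) {m n : ℤ} (h : n ≤ m) :
    v.valuation (v.uniformizer : F) ^ m ≤ v.valuation (v.uniformizer : F) ^ n :=
  zpow_le_zpow_right_of_le_one₀ v.valuation_uniformizer_pos v.valuation_uniformizer_lt_one.le h

/-- **Step 3 of the proof of Stichtenoth Thm. 1.3.1** (one target): for a place `P ∉ S`, `a ∈ F`
and `N ∈ ℤ` there is `z ∈ F` with `v_P(z - a) ≥ N` and `v_Q(z) ≥ N` for all `Q ∈ S`. Proof:
`z = a w` with `w` from Step 2 for a precision `M ≥ N - v_i(a)`.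
[cite: Stichtenoth2009, Thm. 1.3.1 (proof, Step 3)] -/
theorem exists_approx_single (S : Finset (PlaceOver K F)) {P : PlaceOver K F} (hP : P ∉ S)
    (a : F) (N : ℤ) :
    ∃ z : F, P.valuation (z - a) ≤ P.valuation (P.uniformizer : F) ^ N ∧
      ∀ Q ∈ S, Q.valuation z ≤ Q.valuation (Q.uniformizer : F) ^ N := by
  by_cases ha : a = 0
  · refine ⟨0, by simp [ha], fun Q _ ↦ by simp⟩
  set M : ℤ := |N| + |P.ord a| + ∑ Q ∈ S, |Q.ord a| with hM_def
  have hMP : N ≤ P.ord a + M := by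
    have h0 : 0 ≤ ∑ Q ∈ S, |Q.ord a| := Finset.sum_nonneg fun _ _ ↦ abs_nonneg _
    rcases abs_cases N with ⟨h1, _⟩ | ⟨h1, _⟩ <;>
      rcases abs_cases (P.ord a) with ⟨h2, _⟩ | ⟨h2, _⟩ <;> omega
  have hMS : ∀ Q ∈ S, N ≤ Q.ord a + M := fun Q hQ ↦ by
    have h0 : |Q.ord a| ≤ ∑ Q' ∈ S, |Q'.ord a| :=
      Finset.single_le_sum (fun _ _ ↦ abs_nonneg _) hQ (f := fun Q' : PlaceOver K F ↦ |Q'.ord a|)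
    rcases abs_cases N with ⟨h1, _⟩ | ⟨h1, _⟩ <;>
      rcases abs_cases (Q.ord a) with ⟨h2, _⟩ | ⟨h2, _⟩ <;> nlinarith [abs_nonneg (P.ord a)]
  obtain ⟨w, hwP, hwS⟩ := exists_approx_one S hP M
  refine ⟨a * w, ?_, fun Q hQ ↦ ?_⟩
  · rw [← mul_sub_one, Valuation.map_mul, P.valuation_eq_zpow_ord ha]
    calc P.valuation (P.uniformizer : F) ^ P.ord a * P.valuation (w - 1)
        ≤ P.valuation (P.uniformizer : F) ^ P.ord a * P.valuation (P.uniformizer : F) ^ M :=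
          mul_le_mul_right hwP _
      _ = P.valuation (P.uniformizer : F) ^ (P.ord a + M) :=
          (zpow_add₀ P.valuation_uniformizer_ne_zero _ _).symm
      _ ≤ P.valuation (P.uniformizer : F) ^ N := P.zpow_valuation_uniformizer_le_of_le hMP
  · rw [Valuation.map_mul, Q.valuation_eq_zpow_ord ha]
    calc Q.valuation (Q.uniformizer : F) ^ Q.ord a * Q.valuation w
        ≤ Q.valuation (Q.uniformizer : F) ^ Q.ord a * Q.valuation (Q.uniformizer : F) ^ M :=
          mul_le_mul_right (hwS Q hQ) _
      _ = Q.valuation (Q.uniformizer : F) ^ (Q.ord a + M) :=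
          (zpow_add₀ Q.valuation_uniformizer_ne_zero _ _).symm
      _ ≤ Q.valuation (Q.uniformizer : F) ^ N := Q.zpow_valuation_uniformizer_le_of_le (hMS Q hQ)

/-- **Weak approximation, additive form** (Stichtenoth Thm. 1.3.1, proof, Step 3): for finitely
many places `P ∈ S`, targets `a_P ∈ F` and precisions `N_P ∈ ℤ` there is `z ∈ F` with
`v_P(z - a_P) ≥ N_P` for all `P ∈ S`. Proof as printed: `z = ∑_P z_P` with `z_P` close to `a_P` at
`P` and small at the other places of `S`. [cite: Stichtenoth2009, Thm. 1.3.1 (proof, Step 3)] -/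
theorem exists_forall_valuation_sub_le (S : Finset (PlaceOver K F)) (a : PlaceOver K F → F)
    (N : PlaceOver K F → ℤ) :
    ∃ z : F, ∀ P ∈ S, P.valuation (z - a P) ≤ P.valuation (P.uniformizer : F) ^ N P := by
  -- a common precision
  set N₀ : ℤ := ∑ P ∈ S, |N P| with hN₀
  have hN₀le : ∀ P ∈ S, N P ≤ N₀ := fun P hP ↦
    (le_abs_self _).trans (Finset.single_le_sum (fun _ _ ↦ abs_nonneg _) hP (f := fun P ↦ |N P|))
  choose z hz using fun P : PlaceOver K F ↦
    exists_approx_single (S.erase P) (Finset.notMem_erase P S) (a P) N₀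
  refine ⟨∑ P ∈ S, z P, fun P hP ↦ ?_⟩
  rw [← Finset.add_sum_erase S z hP, add_sub_right_comm]
  refine (Valuation.map_add_le _ ((hz P).1.trans (P.zpow_valuation_uniformizer_le_of_le (hN₀le P hP)))
    (Valuation.map_sum_le _ fun Q hQ ↦ ?_))
  have hPQ : P ∈ S.erase Q := Finset.mem_erase.2 ⟨(Finset.mem_erase.1 hQ).1.symm, hP⟩
  exact ((hz Q).2 P hPQ).trans (P.zpow_valuation_uniformizer_le_of_le (hN₀le P hP))

/-- **Stichtenoth Thm. 1.3.1 (Weak Approximation Theorem)**: for pairwise distinct places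
`P₁, …, Pₙ` (a `Finset`), elements `x_P ∈ F` and integers `r_P`, there is `x ∈ F` with
`v_P(x - x_P) = r_P` for every `P` (here: `x - x_P ≠ 0` and `ord_P (x - x_P) = r_P`). Proof as
printed: approximate `x_P` to precision `> r_P` by `z`, approximate `π_P^{r_P}` to precision `> r_P`
by `z'` (so `v_P(z') = r_P` by the strict triangle inequality), and take `x = z + z'`.
[cite: Stichtenoth2009, Thm. 1.3.1] -/
theorem weakApproximation (S : Finset (PlaceOver K F)) (a : PlaceOver K F → F)
    (r : PlaceOver K F → ℤ) :
    ∃ x : F, ∀ P ∈ S, x - a P ≠ 0 ∧ P.ord (x - a P) = r P := by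
  obtain ⟨z, hz⟩ := exists_forall_valuation_sub_le S a (fun P ↦ r P + 1)
  obtain ⟨z', hz'⟩ := exists_forall_valuation_sub_le S
    (fun P ↦ (P.uniformizer : F) ^ (r P)) (fun P ↦ r P + 1)
  refine ⟨z + z', fun P hP ↦ ?_⟩
  have hπ : (P.uniformizer : F) ^ r P ≠ 0 := zpow_ne_zero _ P.coe_uniformizer_ne_zero
  -- `v_P(z') = r_P`
  have hz'P : z' ≠ 0 ∧ P.ord z' = r P := by
    have hlt : P.valuation (z' - (P.uniformizer : F) ^ r P) <
        P.valuation ((P.uniformizer : F) ^ r P) := by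
      rw [map_zpow₀]
      exact (hz' P hP).trans_lt (P.zpow_valuation_uniformizer_strictAnti (lt_add_one _))
    have h := Valuation.map_add_eq_of_lt_left _ hlt
    rw [add_sub_cancel, map_zpow₀] at h
    have hz'0 : z' ≠ 0 := by
      rintro rfl
      rw [Valuation.map_zero] at h
      exact zpow_ne_zero _ P.valuation_uniformizer_ne_zero h.symm
    exact ⟨hz'0, (P.valuation_eq_zpow_iff_ord_eq hz'0 _).1 h⟩
  -- `v_P((z - a_P) + z') = v_P(z') = r_P`
  have hlt : P.valuation (z - a P) < P.valuation z' := by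
    rw [P.valuation_eq_zpow_ord hz'P.1, hz'P.2]
    exact (hz P hP).trans_lt (P.zpow_valuation_uniformizer_strictAnti (lt_add_one _))
  have h := Valuation.map_add_eq_of_lt_right _ hlt
  have hne : z - a P + z' ≠ 0 := by
    intro h0
    rw [h0, Valuation.map_zero] at h
    exact (Valuation.ne_zero_iff _).2 hz'P.1 h.symm
  refine ⟨by rwa [add_sub_right_comm], ?_⟩
  rw [add_sub_right_comm, ← hz'P.2]
  exact (P.valuation_eq_zpow_iff_ord_eq hne _).1 (h.trans (P.valuation_eq_zpow_ord hz'P.1))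

end PlaceOver

/-! ### Zeros counted with multiplicity: Stichtenoth Prop. 1.3.3 and Cor. 1.3.4 -/

section Zeros

open Polynomial

/-- Generic form of the `K(x)`-linear-independence arguments of Stichtenoth Lemma 1.1.7,
Prop. 1.1.15 and Prop. 1.3.3 ("w.l.o.g. not all `φᵢ(x)` are divisible by `x`", replaced by an
induction on coefficients): let `0 ≠ x ∈ F` and `w₁, …, wₙ ∈ F` be such that *every* relation
`∑ φᵢ(x) wᵢ = 0` with `φᵢ ∈ K[X]` forces all constant terms `φᵢ(0)` to vanish. Then every such
relation forces `φᵢ = 0` for all `i`: the constant terms vanish, so `φᵢ = X ψᵢ`, and cancelling `x`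
gives a relation of the same shape for the `ψᵢ`. [cite: Stichtenoth2009, Prop. 1.3.3 (proof)] -/
theorem eq_zero_of_sum_aeval_mul_eq_zero {x : F} (hx0 : x ≠ 0) {ι : Type*} [Fintype ι] {w : ι → F}
    (base : ∀ p : ι → K[X], ∑ i, aeval x (p i) * w i = 0 → ∀ i, (p i).coeff 0 = 0)
    {p : ι → K[X]} (hp : ∑ i, aeval x (p i) * w i = 0) (i : ι) : p i = 0 := by
  suffices h : ∀ (n : ℕ) {p : ι → K[X]}, ∑ i, aeval x (p i) * w i = 0 → ∀ i, (p i).coeff n = 0 from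
    Polynomial.ext fun n ↦ by simpa using h n hp i
  intro n
  induction n with
  | zero => exact fun hp ↦ base _ hp
  | succ n ih =>
    intro p hp i
    have h0 := base p hp
    have hp' : ∑ i, aeval x (divX (p i)) * w i = 0 := by
      have : ∑ i, aeval x (p i) * w i = x * ∑ i, aeval x (divX (p i)) * w i := by
        rw [Finset.mul_sum]
        refine Finset.sum_congr rfl fun j _ ↦ ?_
        conv_lhs => rw [← divX_mul_X_add (p j), h0 j, map_zero, add_zero, map_mul, aeval_X]
        ring
      rw [this] at hp
      exact (mul_eq_zero.1 hp).resolve_left hx0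
    rw [← coeff_divX]
    exact ih hp' i

open scoped IntermediateField.algebraAdjoinAdjoin in
/-- From `K[x]`-relations to `K(x)`-linear independence (used in Stichtenoth Lemma 1.1.7,
Prop. 1.1.15, Prop. 1.3.3): under the hypothesis of `eq_zero_of_sum_aeval_mul_eq_zero`, the family
`w` is linearly independent over `K(x)` (`K(x) = Frac K[x]`, Mathlib's scoped instances
`IntermediateField.algebraAdjoinAdjoin` and `LinearIndependent.iff_fractionRing`;
`K[x] = aeval x (K[X])`, `Algebra.adjoin_singleton_eq_range_aeval`).
[cite: Stichtenoth2009, Prop. 1.3.3 (proof)] -/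
theorem linearIndependent_adjoin_simple_of_coeff_zero {x : F} (hx0 : x ≠ 0) {ι : Type*} [Fintype ι]
    {w : ι → F}
    (base : ∀ p : ι → K[X], ∑ i, aeval x (p i) * w i = 0 → ∀ i, (p i).coeff 0 = 0) :
    LinearIndependent (IntermediateField.adjoin K {x}) w := by
  rw [← LinearIndependent.iff_fractionRing (Algebra.adjoin K {x})
    (IntermediateField.adjoin K {x}), Fintype.linearIndependent_iff]
  intro g hg
  have hmem : ∀ i, (g i : F) ∈ (aeval x).range := fun i ↦ by
    rw [← Algebra.adjoin_singleton_eq_range_aeval]; exact (g i).2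
  choose p hp using fun i ↦ (AlgHom.mem_range _).1 (hmem i)
  have hsum : ∑ i, aeval x (p i) * w i = 0 := by
    simpa only [Subalgebra.smul_def, smul_eq_mul, hp] using hg
  intro i
  apply Subtype.ext
  rw [← hp i, eq_zero_of_sum_aeval_mul_eq_zero hx0 base hsum i, map_zero]
  rfl

/-- Residue-class step shared by Stichtenoth Prop. 1.1.15 and Prop. 1.3.3: if `x ∈ P` (i.e.
`x̄ = 0` in `F_P`), `r₁, …, rₙ ∈ O_P` have `K`-linearly independent residues, and
`∑ φⱼ(x) rⱼ ∈ P` for polynomials `φⱼ ∈ K[X]`, then all constant terms `φⱼ(0)` vanish (reduce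
modulo `P`: `∑ φⱼ(0) r̄ⱼ = 0`). [cite: Stichtenoth2009, Prop. 1.3.3 (proof, (1.16))] -/
theorem PlaceOver.coeff_zero_eq_zero_of_residue_sum_eq_zero (v : PlaceOver K F)
    {x : v.toValuationSubring} (hx : IsLocalRing.residue _ x = 0) {ι : Type*} [Fintype ι]
    {r : ι → v.toValuationSubring} (hr : LinearIndependent K fun i ↦ IsLocalRing.residue _ (r i))
    {p : ι → K[X]} (hp : IsLocalRing.residue _ (∑ i, aeval x (p i) * r i) = 0) (i : ι) :
    (p i).coeff 0 = 0 := by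
  have key : ∀ j, IsLocalRing.residue _ (aeval x (p j)) =
      algebraMap K v.residueField ((p j).coeff 0) := by
    intro j
    rw [← IsLocalRing.ResidueField.algebraMap_eq, ← aeval_algebraMap_apply,
      IsLocalRing.ResidueField.algebraMap_eq, hx, coeff_zero_eq_aeval_zero']
  simp only [map_sum, map_mul, key, ← Algebra.smul_def] at hp
  exact Fintype.linearIndependent_iff.1 hr _ hp i

/-- **The heart of Stichtenoth Prop. 1.3.3** (the computation (1.13)–(1.16) of the printed proof,
in the variant described at `sum_ord_mul_degree_le_finrank`). Data: finitely many places `P ∈ T`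
at which `x` has a zero, exponents `e_P` with `v_P(x) ≥ e_P`, elements `s_{P,j} ∈ O_P`
(`j < d_P`) with `K`-linearly independent residues, and elements `w_{P,a,j} ∈ F` (`a < e_P`) with
`v_P(w_{P,a,j} - π_P^a s_{P,j}) ≥ e_P` and `v_Q(w_{P,a,j}) ≥ e_Q` for `P ≠ Q ∈ T`. Claim: a relation
`∑ φ_i(x) w_i = 0` with `φ_i ∈ K[X]` forces all constant terms `φ_i(0)` to vanish. Proof: fix `P`
and do strong induction on `c < e_P`; multiplying by `π_P^{-c}`, every term of the relation
except `∑_j φ_{P,c,j}(x) s_{P,j}` has positive valuation at `P`, so this sum lies in `P`, and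
reducing modulo `P` (`x ≡ 0`) gives `∑_j φ_{P,c,j}(0) s̄_{P,j} = 0`.
[cite: Stichtenoth2009, Prop. 1.3.3 (proof)] -/
theorem coeff_zero_eq_zero_of_sum_aeval_mul_approx_eq_zero (T : Finset (PlaceOver K F)) {x : F}
    (hx0 : x ≠ 0) (hT : ∀ P ∈ T, 0 < P.ord x) {e d : PlaceOver K F → ℕ}
    (hxv : ∀ P ∈ T, P.valuation x ≤ P.valuation (P.uniformizer : F) ^ (e P : ℤ))
    {s : ∀ P : PlaceOver K F, Fin (d P) → P.toValuationSubring}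
    (hs : ∀ P ∈ T, LinearIndependent K fun j ↦ IsLocalRing.residue _ (s P j))
    {w : (Σ P : T, Fin (e P) × Fin (d P)) → F}
    (hw₁ : ∀ i : (Σ P : T, Fin (e P) × Fin (d P)),
      i.1.1.valuation (w i - (i.1.1.uniformizer : F) ^ (i.2.1 : ℕ) * (s i.1.1 i.2.2 : F)) ≤
        i.1.1.valuation (i.1.1.uniformizer : F) ^ (e i.1.1 : ℤ))
    (hw₂ : ∀ i : (Σ P : T, Fin (e P) × Fin (d P)), ∀ Q ∈ T, Q ≠ i.1.1 →
      Q.valuation (w i) ≤ Q.valuation (Q.uniformizer : F) ^ (e Q : ℤ))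
    {p : (Σ P : T, Fin (e P) × Fin (d P)) → K[X]} (hp : ∑ i, aeval x (p i) * w i = 0)
    (i : Σ P : T, Fin (e P) × Fin (d P)) : (p i).coeff 0 = 0 := by
  classical
  have hxO : ∀ P ∈ T, x ∈ P.toValuationSubring := fun P hP ↦
    (P.mem_toValuationSubring_iff_ord_nonneg hx0).2 (hT P hP).le
  -- the targets `t_i = π^a s`
  have ht1 : ∀ i : (Σ P : T, Fin (e P) × Fin (d P)),
      i.1.1.valuation ((i.1.1.uniformizer : F) ^ (i.2.1 : ℕ) * (s i.1.1 i.2.2 : F)) ≤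
        i.1.1.valuation (i.1.1.uniformizer : F) ^ ((i.2.1 : ℕ) : ℤ) := by
    intro i
    rw [Valuation.map_mul, map_pow, zpow_natCast]
    exact mul_le_of_le_one_right' (i.1.1.toValuationSubring.valuation_le_one _)
  -- all `w_i` lie in every `O_P`, `P ∈ T`
  have hwle : ∀ (P : T) (i : Σ P : T, Fin (e P) × Fin (d P)), P.1.valuation (w i) ≤ 1 := by
    intro P i
    have hone : ∀ (Q : PlaceOver K F) (n : ℕ),
        Q.valuation (Q.uniformizer : F) ^ (n : ℤ) ≤ 1 := fun Q n ↦ by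
      rw [← zpow_zero (Q.valuation (Q.uniformizer : F))]
      exact Q.zpow_valuation_uniformizer_le_of_le (by positivity)
    by_cases hi : i.1 = P
    · have h1 : i.1.1.valuation (w i) ≤ 1 := by
        rw [← sub_add_cancel (w i) ((i.1.1.uniformizer : F) ^ (i.2.1 : ℕ) * (s i.1.1 i.2.2 : F))]
        exact Valuation.map_add_le _ ((hw₁ i).trans (hone _ _)) ((ht1 i).trans (hone _ _))
      rwa [hi] at h1
    · exact (hw₂ i P.1 P.2 fun h ↦ hi (Subtype.ext h.symm)).trans (hone _ _)
  -- polynomials in `x` lie in `O_P`, and in `x O_P` if the constant term vanishes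
  have hpol1 : ∀ (P : T) (q : K[X]), P.1.valuation (aeval x q) ≤ 1 := by
    intro P q
    have : aeval x q = ((aeval (⟨x, hxO P.1 P.2⟩ : P.1.toValuationSubring) q :
        P.1.toValuationSubring) : F) :=
      aeval_algebraMap_apply (B := F) (⟨x, hxO P.1 P.2⟩ : P.1.toValuationSubring) q
    rw [this]
    exact P.1.toValuationSubring.valuation_le_one _
  have hpol0 : ∀ (P : T) (q : K[X]), q.coeff 0 = 0 →
      P.1.valuation (aeval x q) ≤ P.1.valuation (P.1.uniformizer : F) ^ (e P.1 : ℤ) := by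
    intro P q hq
    have : aeval x q = x * aeval x (divX q) := by
      conv_lhs => rw [← X_mul_divX_add q, hq, map_zero, add_zero, map_mul, aeval_X]
    rw [this, Valuation.map_mul]
    exact (mul_le_of_le_one_right' (hpol1 P _)).trans (hxv P.1 P.2)
  -- reduce to: for fixed `P`, strong induction on `c`
  suffices key : ∀ (P : T) (c : ℕ) (hc : c < e P.1) (j : Fin (d P.1)),
      (p ⟨P, ⟨c, hc⟩, j⟩).coeff 0 = 0 from key i.1 i.2.1 i.2.1.2 i.2.2
  intro P c
  induction c using Nat.strong_induction_on with
  | _ c ih =>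
  intro hc j₀
  have hγ0 : P.1.valuation (P.1.uniformizer : F) ≠ 0 := P.1.valuation_uniformizer_ne_zero
  have hγc : ∀ {n : ℤ}, (c : ℤ) < n →
      P.1.valuation (P.1.uniformizer : F) ^ n < P.1.valuation (P.1.uniformizer : F) ^ (c : ℤ) :=
    fun h ↦ P.1.zpow_valuation_uniformizer_strictAnti h
  have hce : (c : ℤ) < (e P.1 : ℕ) := by exact_mod_cast hc
  -- the main parts `m_i`
  obtain ⟨m, hm⟩ : ∃ m : (Σ P : T, Fin (e P) × Fin (d P)) → F, ∀ i, m i =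
      if i.1 = P ∧ (i.2.1 : ℕ) = c then (i.1.1.uniformizer : F) ^ (i.2.1 : ℕ) * (s i.1.1 i.2.2 : F)
      else 0 := ⟨_, fun i ↦ rfl⟩
  -- every `φ_i(x) (w_i - m_i)` has valuation `< γ^c`: first the indices at `P` …
  have htermP : ∀ (a : Fin (e P.1)) (j : Fin (d P.1)),
      P.1.valuation (aeval x (p ⟨P, a, j⟩) * (w ⟨P, a, j⟩ - m ⟨P, a, j⟩)) <
        P.1.valuation (P.1.uniformizer : F) ^ (c : ℤ) := by
    intro a j
    rw [Valuation.map_mul]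
    by_cases hac : (a : ℕ) = c
    · -- `a = c`: `w - m = w - t`, of valuation `≤ γ^e < γ^c`
      rw [hm, if_pos ⟨rfl, hac⟩]
      exact (mul_le_of_le_one_left' (hpol1 P _)).trans_lt ((hw₁ ⟨P, a, j⟩).trans_lt (hγc hce))
    · rw [hm, if_neg fun h ↦ hac h.2, sub_zero]
      rcases lt_or_gt_of_ne hac with hlt | hgt
      · -- `a < c`: the constant term of `φ` vanishes, `v(φ(x)) ≤ γ^e < γ^c`, `v(w) ≤ 1`
        have h0 : (p ⟨P, a, j⟩).coeff 0 = 0 := ih a hlt a.2 j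
        exact (mul_le_of_le_one_right' (hwle P _)).trans_lt ((hpol0 P _ h0).trans_lt (hγc hce))
      · -- `a > c`: `v(w) ≤ max (γ^a, γ^e) < γ^c`
        refine (mul_le_of_le_one_left' (hpol1 P _)).trans_lt ?_
        rw [← sub_add_cancel (w ⟨P, a, j⟩) ((P.1.uniformizer : F) ^ (a : ℕ) * (s P.1 j : F))]
        exact Valuation.map_add_lt _ ((hw₁ ⟨P, a, j⟩).trans_lt (hγc hce))
          ((ht1 ⟨P, a, j⟩).trans_lt (hγc (by exact_mod_cast hgt)))
  -- … then all indices
  have hterm : ∀ i, P.1.valuation (aeval x (p i) * (w i - m i)) <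
      P.1.valuation (P.1.uniformizer : F) ^ (c : ℤ) := by
    rintro ⟨P', a, j⟩
    by_cases hP' : P' = P
    · subst hP'
      exact htermP a j
    · rw [hm, if_neg fun h ↦ hP' h.1, sub_zero, Valuation.map_mul]
      exact (mul_le_of_le_one_left' (hpol1 P _)).trans_lt
        ((hw₂ ⟨P', a, j⟩ P.1 P.2 fun h ↦ hP' (Subtype.ext h.symm)).trans_lt (hγc hce))
  -- hence `v(∑ φ_i(x) m_i) < γ^c`
  have hsum_m : P.1.valuation (∑ i, aeval x (p i) * m i) <
      P.1.valuation (P.1.uniformizer : F) ^ (c : ℤ) := by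
    have : ∑ i, aeval x (p i) * m i = -∑ i, aeval x (p i) * (w i - m i) := by
      rw [eq_neg_iff_add_eq_zero, ← Finset.sum_add_distrib, ← hp]
      exact Finset.sum_congr rfl fun i _ ↦ by ring
    rw [this, Valuation.map_neg]
    exact Valuation.map_sum_lt _ (zpow_ne_zero _ hγ0) fun i _ ↦ hterm i
  -- and `∑ φ_i(x) m_i = π^c · y` with `y = ∑_j φ_{P,c,j}(x) s_{P,j} ∈ O_P`
  obtain ⟨x', hx'⟩ : ∃ x' : P.1.toValuationSubring, (x' : F) = x := ⟨⟨x, hxO P.1 P.2⟩, rfl⟩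
  have hco : ∀ q : K[X], ((aeval x' q : P.1.toValuationSubring) : F) = aeval x q := fun q ↦ by
    rw [← hx']; exact (aeval_algebraMap_apply (B := F) x' q).symm
  have hY : ∑ i, aeval x (p i) * m i = (P.1.uniformizer : F) ^ c *
      ((∑ j, aeval x' (p ⟨P, ⟨c, hc⟩, j⟩) * s P.1 j : P.1.toValuationSubring) : F) := by
    simp only [AddSubmonoidClass.coe_finsetSum, MulMemClass.coe_mul, hco, Finset.mul_sum]
    rw [Fintype.sum_sigma, Finset.sum_eq_single P (fun P' _ hP' ↦ Finset.sum_eq_zero fun q _ ↦ by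
      rw [hm, if_neg fun h ↦ hP' h.1, mul_zero])
      (fun h ↦ (h (Finset.mem_univ _)).elim),
      Fintype.sum_prod_type, Finset.sum_eq_single (⟨c, hc⟩ : Fin (e P.1))
        (fun a _ ha ↦ Finset.sum_eq_zero fun j _ ↦ by
          rw [hm, if_neg fun h ↦ ha (Fin.ext h.2), mul_zero])
        (fun h ↦ (h (Finset.mem_univ _)).elim)]
    refine Finset.sum_congr rfl fun j _ ↦ ?_
    rw [hm, if_pos ⟨rfl, rfl⟩]
    ring
  -- so `v(y) < 1`, i.e. `y ∈ P`
  have hYv : P.1.valuation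
      ((∑ j, aeval x' (p ⟨P, ⟨c, hc⟩, j⟩) * s P.1 j : P.1.toValuationSubring) : F) < 1 := by
    rw [hY, Valuation.map_mul, map_pow, ← zpow_natCast] at hsum_m
    by_contra hge
    rw [not_lt] at hge
    exact (lt_irrefl _) ((le_mul_of_one_le_right' hge).trans_lt hsum_m)
  have hYres : IsLocalRing.residue _
      (∑ j, aeval x' (p ⟨P, ⟨c, hc⟩, j⟩) * s P.1 j : P.1.toValuationSubring) = 0 := by
    rw [IsLocalRing.residue_eq_zero_iff]
    exact (P.1.toValuationSubring.valuation_lt_one_iff _).2 hYv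
  -- reduce modulo `P`
  have hx'res : IsLocalRing.residue _ x' = 0 := by
    rw [IsLocalRing.residue_eq_zero_iff]
    refine (P.1.toValuationSubring.valuation_lt_one_iff x').2 ?_
    change P.1.valuation (x' : F) < 1
    rw [hx', P.1.valuation_lt_one_iff_ord_pos hx0]
    exact hT P.1 P.2
  exact P.1.coeff_zero_eq_zero_of_residue_sum_eq_zero hx'res (hs P.1 P.2) hYres j₀

/-- **Stichtenoth Prop. 1.3.3.** Let `x ∈ F` be transcendental over `K` and let `P₁, …, P_r`
(a `Finset` `T`) be zeros of `x`. Then `∑ᵢ v_{Pᵢ}(x) · deg Pᵢ ≤ [F : K(x)]`.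

Proof (a variant of the printed one, avoiding the auxiliary elements `tᵢ` with `v_k(tᵢ) = 0`):
for `P ∈ T`, `0 ≤ a < e_P := v_P(x)` and `s_{P,j} ∈ O_P` lifting a `K`-basis of `F_P`
(`1 ≤ j ≤ deg P`), the weak approximation theorem (additive form,
`exists_forall_valuation_sub_le`) gives `w_{P,a,j} ∈ F` with `v_P(w_{P,a,j} - π_P^a s_{P,j}) ≥ e_P`
and `v_Q(w_{P,a,j}) ≥ e_Q` for `Q ∈ T ∖ {P}`. These `∑ e_P deg P` elements are linearly
independent over `K(x)`: given `∑ φ_i(x) w_i = 0` with `φ_i ∈ K[X]`, all constant terms vanish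
(`coeff_zero_eq_zero_of_sum_aeval_mul_approx_eq_zero`, the computation (1.13)–(1.16) of the
printed proof), and `eq_zero_of_sum_aeval_mul_eq_zero` finishes. Finally a `K(x)`-linearly
independent family in `F` has at most `[F : K(x)]` members (Remark 1.1.2: `[F : K(x)] < ∞`).
[cite: Stichtenoth2009, Prop. 1.3.3] -/
theorem sum_ord_mul_degree_le_finrank [IsAlgFunctionField K F] {x : F} (hx : Transcendental K x)
    (T : Finset (PlaceOver K F)) (hT : ∀ P ∈ T, 0 < P.ord x) :
    ∑ P ∈ T, (P.ord x).toNat * P.degree ≤ Module.finrank (IntermediateField.adjoin K {x}) F := by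
  classical
  haveI := IsAlgFunctionField.finiteDimensional_adjoin_simple hx
  have hx0 : x ≠ 0 := fun h ↦ hx (h ▸ isAlgebraic_zero)
  -- multiplicities `e_P = v_P(x)`
  set e : PlaceOver K F → ℕ := fun P ↦ (P.ord x).toNat with he
  have he' : ∀ P ∈ T, ((e P : ℕ) : ℤ) = P.ord x := fun P hP ↦ Int.toNat_of_nonneg (hT P hP).le
  have hxv : ∀ P ∈ T, P.valuation x ≤ P.valuation (P.uniformizer : F) ^ (e P : ℤ) := fun P hP ↦ by
    rw [P.valuation_le_zpow_iff_le_ord hx0, he' P hP]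
  -- bases of the residue fields, lifted to the valuation rings
  have hs : ∀ P : PlaceOver K F, ∃ s : Fin P.degree → P.toValuationSubring,
      LinearIndependent K fun j ↦ IsLocalRing.residue _ (s j) := by
    intro P
    haveI : FiniteDimensional K P.residueField := PlaceOver.finiteDimensional_residueField_holds P
    let b := Module.finBasis K P.residueField
    choose s hs using fun j : Fin P.degree ↦ IsLocalRing.residue_surjective (R := P.toValuationSubring) (b j)
    refine ⟨s, ?_⟩
    simp only [hs]
    exact b.linearIndependent
  choose s hs using hs
  -- approximants
  have hw : ∀ i : (Σ P : T, Fin (e P) × Fin P.1.degree), ∃ w : F,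
      i.1.1.valuation (w - (i.1.1.uniformizer : F) ^ (i.2.1 : ℕ) * (s i.1.1 i.2.2 : F)) ≤
        i.1.1.valuation (i.1.1.uniformizer : F) ^ (e i.1.1 : ℤ) ∧
      ∀ Q ∈ T, Q ≠ i.1.1 → Q.valuation w ≤ Q.valuation (Q.uniformizer : F) ^ (e Q : ℤ) := by
    intro i
    obtain ⟨z, hz⟩ := PlaceOver.exists_forall_valuation_sub_le T
      (fun Q ↦ if Q = i.1.1 then (i.1.1.uniformizer : F) ^ (i.2.1 : ℕ) * (s i.1.1 i.2.2 : F) else 0)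
      (fun Q ↦ (e Q : ℤ))
    refine ⟨z, by simpa using hz i.1.1 i.1.2, fun Q hQ hQi ↦ ?_⟩
    simpa [hQi] using hz Q hQ
  choose w hw using hw
  -- linear independence over `K(x)` and the count
  have hli := linearIndependent_adjoin_simple_of_coeff_zero hx0 fun p hp i ↦
    coeff_zero_eq_zero_of_sum_aeval_mul_approx_eq_zero T hx0 hT hxv (fun P _ ↦ hs P)
      (fun i ↦ (hw i).1) (fun i ↦ (hw i).2) hp i
  have hcard := hli.fintype_card_le_finrank
  have hι : Fintype.card (Σ P : T, Fin (e P) × Fin P.1.degree) = ∑ P ∈ T, e P * P.degree := by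
    simp only [Fintype.card_sigma, Fintype.card_prod, Fintype.card_fin]
    exact Finset.sum_coe_sort T (fun P ↦ e P * P.degree)
  rwa [hι] at hcard

/-- The zeros of a transcendental element form a finite set (first half of Stichtenoth
Cor. 1.3.4): by Prop. 1.3.3 any finite set of zeros has at most `[F : K(x)]` elements (each term
`v_P(x) · deg P` of the sum being `≥ 1`). [cite: Stichtenoth2009, Cor. 1.3.4] -/
theorem finite_setOf_ord_pos [IsAlgFunctionField K F] {x : F} (hx : Transcendental K x) :
    {v : PlaceOver K F | 0 < v.ord x}.Finite := by
  by_contra hinf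
  obtain ⟨T, hTsub, hTcard⟩ := Set.Infinite.exists_subset_card_eq hinf
    (Module.finrank (IntermediateField.adjoin K {x}) F + 1)
  have hT : ∀ P ∈ T, 0 < P.ord x := fun P hP ↦ hTsub (Finset.mem_coe.2 hP)
  have h := sum_ord_mul_degree_le_finrank hx T hT
  have hle : T.card ≤ ∑ P ∈ T, (P.ord x).toNat * P.degree := by
    rw [Finset.card_eq_sum_ones]
    refine Finset.sum_le_sum fun P hP ↦ ?_
    have h1 : 1 ≤ (P.ord x).toNat := by have := hT P hP; omega
    exact one_le_mul h1 (PlaceOver.one_le_degree P)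
  omega

/-- An element algebraic over `K` has neither zeros nor poles: `ord_v x = 0` for `x ≠ 0` algebraic
(Stichtenoth Prop. 1.1.5 (c): `K̃ ⊆ O_P` and `K̃ ∩ P = {0}`; proof of Cor. 1.3.4: "if `x` is
constant, `x` has neither zeros nor poles"). [cite: Stichtenoth2009, Prop. 1.1.5(c) and Cor. 1.3.4] -/
theorem PlaceOver.ord_eq_zero_of_isAlgebraic (v : PlaceOver K F) {x : F} (hx0 : x ≠ 0)
    (hx : IsAlgebraic K x) : v.ord x = 0 := by
  have h1 := IsAlgFunctionField.mem_valuationSubring_of_isAlgebraic v.toValuationSubring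
    v.algebraMap_mem hx
  have h2 := IsAlgFunctionField.mem_valuationSubring_of_isAlgebraic v.toValuationSubring
    v.algebraMap_mem (IsAlgebraic.inv_iff.2 hx)
  rw [v.mem_toValuationSubring_iff_ord_nonneg hx0] at h1
  rw [v.mem_toValuationSubring_iff_ord_nonneg (inv_ne_zero hx0), v.ord_inv hx0] at h2
  omega

/-- **Discharge of `finite_setOf_ord_ne_zero` (Stichtenoth Cor. 1.3.4):** in an algebraic function
field of one variable every `0 ≠ x ∈ F` has only finitely many zeros and poles. Proof as printed:
a constant (= algebraic over `K`) has neither zeros nor poles (`ord_eq_zero_of_isAlgebraic`); if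
`x` is transcendental, its zeros are finitely many by Prop. 1.3.3 (`finite_setOf_ord_pos`), and
its poles are the zeros of the transcendental element `x⁻¹`. [cite: Stichtenoth2009, Cor. 1.3.4] -/
theorem finite_setOf_ord_ne_zero_holds : finite_setOf_ord_ne_zero (K := K) (F := F) := by
  intro _ x hx0
  by_cases hx : IsAlgebraic K x
  · convert Set.finite_empty
    ext v
    simp [v.ord_eq_zero_of_isAlgebraic hx0 hx]
  · have hzer := finite_setOf_ord_pos (K := K) (x := x) hx
    have hpol := finite_setOf_ord_pos (K := K) (x := x⁻¹) (fun h ↦ hx (IsAlgebraic.inv_iff.1 h))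
    refine (hzer.union hpol).subset fun v hv ↦ ?_
    simp only [Set.mem_setOf_eq, Set.mem_union] at hv ⊢
    rw [v.ord_inv hx0]
    omega

/-- Pointwise form of `finite_setOf_ord_ne_zero_holds` (Stichtenoth Cor. 1.3.4).
[cite: Stichtenoth2009, Cor. 1.3.4] -/
theorem finite_setOf_ord_ne_zero_of_ne_zero [IsAlgFunctionField K F] {x : F} (hx : x ≠ 0) :
    {v : PlaceOver K F | v.ord x ≠ 0}.Finite :=
  finite_setOf_ord_ne_zero_holds hx

/-- Hence the principal divisor is never in its junk case: `(x)(v) = ord_v x` for `x ≠ 0` in an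
algebraic function field of one variable (Stichtenoth Def. 1.4.2 with Cor. 1.3.4).
[cite: Stichtenoth2009, Def. 1.4.2 and Cor. 1.3.4] -/
theorem principalDivisor_apply_of_ne_zero [IsAlgFunctionField K F] {x : F} (hx : x ≠ 0)
    (v : PlaceOver K F) : principalDivisor K x v = v.ord x :=
  principalDivisor_apply (finite_setOf_ord_ne_zero_holds hx) v

end Zeros

end Literature.NumberTheory.DiophantineGeometry.AlgFunctionField
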